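import Summits.Parity.GeneralizedHardyLittlewood.Theorems.LeeYangFibresRelativeDimOneMoebiusSplitMoebiusTermBVAux4
import Summits.Parity.GeneralizedHardyLittlewood.Theorems.LeeYangFibresAbsoluteUpgradeSinglesDecayAP
import Literature.NumberTheory.Sieve.LinearEquationsInPrimesDimOne
import HarnessLib

/-!
# Route `LeeYangFibres`, crux `RelativeDimOne` (stmt-Parity-14113), line `single-moebius-split`:
# helper file 6 for the stub `stub_moebiusTermBV` — the bound for one sieve tuple

`tupleBound`: fix a `d = 1` system `Ψ = (ψ₀, …, ψ_k)` (`ψ_i(m) = a_i m + b_i`, `a_i ≠ 0`, `|a₀| ≤ L`,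
`|b₀| ≤ LN`), an integer interval `[m₁, m₂] ⊆ [-N, N]` on which `ψ₀ ≥ 1`, and a tuple `t = (t_i)_{i ≥ 1}`
of sieve moduli.  The `m ∈ [m₁, m₂]` with `t_i ∣ ψ_i(m)` for all `i ≥ 1` form one residue class modulo
`M_t` (helper file 1, `affCongr_singleClass`), whose image under `ψ₀` is a class modulo
`Q = |a₀| M_t` in a segment of `(0, 2LN]` (`AbsoluteUpgrade.sum_filter_Icc_modEq_eq`, with the
reflection `m ↦ −m` when `a₀ < 0`); so helper file 4 (`classEstimate`) bounds
`∑_{m} (Λ − Λ_R)(ψ₀(m))` over these `m` by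
`2 G(Q) + Q (log₂ X + 1) log X + (X/Q) τ(Q) C e^{−c√log Rmin} + R (log R + 1)`, `X = 2LN`.  The
modulus `Q` is returned together with the divisibility data (`Q ∣ |a₀| ∏ t_i`, `t_i = g m` with
`g ∣ |a_i|`, `m ∣ Q`) used to count the tuples sharing a modulus.

References: D. A. Goldston, C. Y. Yıldırım, Integers 3 (2003) A5, §"mixed correlations"
[GoldstonYildirim2001]; H. Iwaniec, E. Kowalski, *Analytic Number Theory* (2004), Thm. 17.1
[IwaniecKowalski2004].
-/

noncomputable section

open Finset Literature.NumberTheory.Sieve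
open scoped ArithmeticFunction.vonMangoldt

namespace Summit.Parity.GeneralizedHardyLittlewood.Cruxes.RelativeDimOne.SingleMoebiusSplit

open Literature.NumberTheory.Sieve.ParityWave0 (chebyshevPsiMod)
open Summit.Parity.GeneralizedHardyLittlewood.Theorems.AbsoluteUpgrade (sum_filter_Icc_modEq_eq
  sum_filter_Icc_modEq_neg)

/-- A class `r (mod Q)` of `ℕ` described by an integer residue is the class of the natural residue
`(r mod Q)`. [folklore] -/
theorem filter_intModEq_eq_filter_modEq {Q : ℕ} (hQ : 0 < Q) (r : ℤ) (s : Finset ℕ) :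
    s.filter (fun v : ℕ => (v : ℤ) ≡ r [ZMOD Q]) = s.filter (fun v : ℕ => v ≡ (r % Q).toNat [MOD Q]) := by
  -- adapted from `AbsoluteUpgrade.card_filter_Ioc_intModEq_le`
  set c := (r % Q).toNat with hc
  have hq' : (0 : ℤ) < Q := by exact_mod_cast hQ
  have hc0 : 0 ≤ r % Q := Int.emod_nonneg _ hq'.ne'
  have hceq : ((c : ℕ) : ℤ) = r % Q := Int.toNat_of_nonneg hc0
  have hclt : c < Q := by
    have h1 := Int.emod_lt_of_pos r hq'
    rw [← hceq] at h1
    exact_mod_cast h1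
  refine Finset.filter_congr fun v _ => ?_
  rw [Nat.ModEq, Nat.mod_eq_of_lt hclt]
  have e : ((v : ℤ) ≡ r [ZMOD (Q : ℤ)]) ↔ ((v % Q : ℕ) : ℤ) = ((c : ℕ) : ℤ) := by
    rw [hceq, Int.natCast_mod]
    rfl
  rw [e]
  exact Int.natCast_inj

/-- **The bound for one sieve tuple.** See the file header. [cite: GoldstonYildirim2001, §"mixed correlations"] -/
theorem tupleBound : ∃ c C : ℝ, 0 < c ∧ 0 ≤ C ∧ ∀ (k : ℕ) (Ψ : Fin (k + 1) → AffLinForm 1) (L N X : ℕ) (m₁ m₂ : ℤ) (t : Fin k → ℕ), (∀ i, (Ψ i).coeff 0 ≠ 0) → ((Ψ 0).coeff 0).natAbs ≤ L → ((Ψ 0).const).natAbs ≤ L * N → -(N : ℤ) ≤ m₁ → m₂ ≤ N → (∀ m ∈ Finset.Icc m₁ m₂, 1 ≤ (Ψ 0).eval (fun _ => m)) → (∀ i, 0 < t i) → X = 2 * L * N → 1 ≤ N → ∃ Q : ℕ, 0 < Q ∧ Q ∣ ((Ψ 0).coeff 0).natAbs * ∏ i, t i ∧ (∀ i, ∃ g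 m : ℕ, g ∣ ((Ψ i.succ).coeff 0).natAbs ∧ m ∣ Q ∧ t i = g * m) ∧ ∀ (R Rmin : ℝ), 1 ≤ Rmin → Rmin * Q ≤ R → (Q : ℝ) ≤ Rmin → ∀ Gq : ℝ, (∀ w : ℕ, 1 ≤ w → w ≤ X → ∀ u : (ZMod Q)ˣ, |chebyshevPsiMod Q (u : ZMod Q) w - w / Nat.totient Q| ≤ Gq) → |∑ m ∈ (Finset.Icc m₁ m₂).filter (fun m => ∀ i, ((t i : ℕ) : ℤ) ∣ (Ψ i.succ).eval (fun _ => m)), (intVonMangoldt ((Ψ 0).eval fun _ => m) - lambdaR R ((Ψ 0).eval fun _ => m))| ≤ 2 * Gq + Q * (Nat.log 2 X + 1) * Real.log X + (X : ℝ) / Q * Q.divisors.card * (C * Real.exp (-c * Real.sqrt (Real.log Rmin))) + R * (Real.log R + 1) := by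
  classical
  obtain ⟨c, C, hc, hC, hCE⟩ := classEstimate
  refine ⟨c, C, hc, hC, ?_⟩
  intro k Ψ L N X m₁ m₂ t hcoeff haL hbL hm₁ hm₂ hpos ht hX hN
  -- the data of the forms
  set a : ℤ := (Ψ 0).coeff 0 with ha
  set b : ℤ := (Ψ 0).const with hb
  set α : Fin k → ℤ := fun i => (Ψ i.succ).coeff 0 with hα
  set β : Fin k → ℤ := fun i => (Ψ i.succ).const with hβ
  have ha0 : a ≠ 0 := hcoeff 0
  obtain ⟨M, hM0, hMdvd, hMfac, hMclass⟩ :=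
    affCongr_singleClass k α β t (fun i => hcoeff i.succ) ht
  set Q : ℕ := a.natAbs * M with hQ
  have haabs : 0 < a.natAbs := Int.natAbs_pos.2 ha0
  have hQ0 : 0 < Q := Nat.mul_pos haabs hM0
  refine ⟨Q, hQ0, mul_dvd_mul_left _ hMdvd, fun i => ?_, ?_⟩
  · obtain ⟨g, m, hg, hm, htm⟩ := hMfac i
    exact ⟨g, m, hg, dvd_trans hm (Dvd.intro_left _ rfl), htm⟩
  intro R Rmin hRmin hRQ hQR Gq hG
  -- sizes
  have hL1 : 1 ≤ L := le_trans haabs haL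
  have hX2 : 2 ≤ X := by rw [hX]; nlinarith
  have hX1 : 1 ≤ X := by omega
  have hGq0 : 0 ≤ Gq := by
    haveI : NeZero Q := ⟨hQ0.ne'⟩
    exact le_trans (abs_nonneg _) (hG 1 le_rfl hX1 1)
  have hQ1 : (1 : ℝ) ≤ Q := by exact_mod_cast hQ0
  have hR1 : 1 ≤ R := le_trans (by nlinarith) hRQ
  have hE0 : 0 ≤ C * Real.exp (-c * Real.sqrt (Real.log Rmin)) := mul_nonneg hC (Real.exp_pos _).le
  have hRHS0 : 0 ≤ 2 * Gq + Q * (Nat.log 2 X + 1) * Real.log X +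
      (X : ℝ) / Q * Q.divisors.card * (C * Real.exp (-c * Real.sqrt (Real.log Rmin))) +
      R * (Real.log R + 1) := by
    have h1 : 0 ≤ Real.log X := Real.log_natCast_nonneg X
    have h2 : 0 ≤ Real.log R := Real.log_nonneg hR1
    positivity
  -- the admissible `m`: empty, or one class modulo `M`
  set A := (Finset.Icc m₁ m₂).filter (fun m => ∀ i, ((t i : ℕ) : ℤ) ∣ (Ψ i.succ).eval (fun _ => m))
    with hA
  rcases A.eq_empty_or_nonempty with hAe | ⟨m₀, hm₀⟩
  · rw [hAe, Finset.sum_empty, abs_zero]; exact hRHS0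
  have hm₀' := hm₀
  rw [hA, Finset.mem_filter] at hm₀'
  obtain ⟨hm₀I, hm₀div⟩ := hm₀'
  have hm₁₂ : m₁ ≤ m₂ := by
    rw [Finset.mem_Icc] at hm₀I; omega
  have hsol : ∀ i, (t i : ℤ) ∣ α i * m₀ + β i := by
    intro i; have h := hm₀div i; rwa [DimOne.eval_eq] at h
  have hAeq : A = (Finset.Icc m₁ m₂).filter (fun m : ℤ => m ≡ m₀ [ZMOD M]) := by
    rw [hA]
    refine Finset.filter_congr fun m _ => ?_
    have h := hMclass m₀ m hsol
    simp only [DimOne.eval_eq]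
    rw [h, Int.modEq_iff_dvd]
    exact ⟨fun h1 => (dvd_sub_comm.1 h1), fun h1 => dvd_sub_comm.1 h1⟩
  -- the summand as a function of the value `ψ₀(m) = a m + b ≥ 1`
  set f : ℕ → ℝ := fun v => Λ v - lambdaR R v with hf
  have hsummand : ∀ m ∈ A, intVonMangoldt ((Ψ 0).eval fun _ => m) - lambdaR R ((Ψ 0).eval fun _ => m) =
      f (a * m + b).toNat := by
    intro m hm
    rw [hA, Finset.mem_filter] at hm
    have h1 : 1 ≤ (Ψ 0).eval (fun _ => m) := hpos m hm.1
    rw [DimOne.eval_eq] at h1 ⊢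
    change 1 ≤ a * m + b at h1
    change intVonMangoldt (a * m + b) - lambdaR R (a * m + b) = Λ (a * m + b).toNat - lambdaR R ((a * m + b).toNat : ℕ)
    rw [Int.toNat_of_nonneg (by omega)]
    rfl
  rw [Finset.sum_congr rfl hsummand, hAeq]
  -- push forward to a class modulo `Q` in a segment `(V₁, V₂] ⊆ (0, X]`
  set r : ℤ := a * m₀ + b with hr
  have hbabs : b ≤ L * N := le_trans (le_abs_self b) (by
    rw [Int.abs_eq_natAbs]; exact_mod_cast hbL)
  have hpush : ∃ V₁ V₂ : ℕ, V₁ ≤ V₂ ∧ V₂ ≤ X ∧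
      ∑ m ∈ (Finset.Icc m₁ m₂).filter (fun m : ℤ => m ≡ m₀ [ZMOD M]), f (a * m + b).toNat =
        ∑ v ∈ (Finset.Ioc V₁ V₂).filter (fun v : ℕ => (v : ℤ) ≡ r [ZMOD Q]), f v := by
    have hMZ : (0 : ℤ) < M := by exact_mod_cast hM0
    rcases lt_or_gt_of_ne ha0 with hneg | hposa
    · -- `a < 0`: reflect first
      have ha' : 0 < -a := by omega
      have hQ' : (Q : ℤ) = -a * M := by
        rw [hQ, Nat.cast_mul, Int.natCast_natAbs, abs_of_neg hneg]
      have hposm : 0 < -a * (-m₂) + b := by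
        have := hpos m₂ (Finset.right_mem_Icc.2 hm₁₂)
        rw [DimOne.eval_eq] at this
        change 1 ≤ a * m₂ + b at this
        nlinarith
      refine ⟨(-a * (-m₂ - 1) + b).toNat, (-a * -m₁ + b).toNat, ?_, ?_, ?_⟩
      · exact Int.toNat_le_toNat (by nlinarith)
      · rw [Int.toNat_le, hX]
        push_cast
        have h1 : -a ≤ L := by
          have : ((a.natAbs : ℕ) : ℤ) = -a := by rw [Int.natCast_natAbs, abs_of_neg hneg]
          rw [← this]; exact_mod_cast haL
        have h2 : -m₁ ≤ N := by omega
        nlinarith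
      · rw [sum_filter_Icc_modEq_neg a b m₁ m₂ m₀ (M : ℤ) (fun v => f v.toNat),
          sum_filter_Icc_modEq_eq ha' hMZ hposm (-m₁) (-m₀) f, hQ']
        refine Finset.sum_congr (Finset.filter_congr fun v _ => ?_) fun _ _ => rfl
        rw [hr, show -a * -m₀ + b = a * m₀ + b by ring]
    · -- `a > 0`
      have hQ' : (Q : ℤ) = a * M := by
        rw [hQ, Nat.cast_mul, Int.natCast_natAbs, abs_of_pos hposa]
      have hposm : 0 < a * m₁ + b := by
        have := hpos m₁ (Finset.left_mem_Icc.2 hm₁₂)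
        rw [DimOne.eval_eq] at this
        change 1 ≤ a * m₁ + b at this
        omega
      refine ⟨(a * (m₁ - 1) + b).toNat, (a * m₂ + b).toNat, ?_, ?_, ?_⟩
      · exact Int.toNat_le_toNat (by nlinarith)
      · rw [Int.toNat_le, hX]
        push_cast
        have h1 : a ≤ L := by
          have : ((a.natAbs : ℕ) : ℤ) = a := by rw [Int.natCast_natAbs, abs_of_pos hposa]
          rw [← this]; exact_mod_cast haL
        nlinarith
      · rw [sum_filter_Icc_modEq_eq hposa hMZ hposm m₂ m₀ f, hQ']
  obtain ⟨V₁, V₂, hV, hVX, hsum⟩ := hpush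
  rw [hsum, filter_intModEq_eq_filter_modEq hQ0 r]
  -- the class estimate
  have hmain := hCE Q hQ0 (r % Q).toNat V₁ V₂ X hV hVX hX2 R Rmin hRmin hRQ hQR Gq hG
  refine hmain.trans ?_
  have hW : ((V₂ : ℝ) - V₁) / Q * Q.divisors.card * (C * Real.exp (-c * Real.sqrt (Real.log Rmin))) ≤
      (X : ℝ) / Q * Q.divisors.card * (C * Real.exp (-c * Real.sqrt (Real.log Rmin))) := by
    have h1 : (V₂ : ℝ) - V₁ ≤ X := by
      have : (V₂ : ℝ) ≤ X := by exact_mod_cast hVX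
      have : (0 : ℝ) ≤ V₁ := Nat.cast_nonneg _
      linarith
    have hQ0' : (0 : ℝ) < Q := by linarith
    have h2 : ((V₂ : ℝ) - V₁) / Q ≤ (X : ℝ) / Q := div_le_div_of_nonneg_right h1 hQ0'.le
    exact mul_le_mul_of_nonneg_right (mul_le_mul_of_nonneg_right h2 (Nat.cast_nonneg _)) hE0
  linarith

end Summit.Parity.GeneralizedHardyLittlewood.Cruxes.RelativeDimOne.SingleMoebiusSplit
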